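import Summits.QuantumFields.YangMills.Theses.ToronSmallBall
import Summits.QuantumFields.YangMills.Theorems.SwapTwistDeficitSmallBallDoor
import HarnessLib

/-!
# `ToronSmallBall.Assembly` (item stmt-QuantumFields-23900) — PROVED:
# `ToronCoreRarity → OffCoreStripWindow → SwapTwistDeficit.TwistDeficitLaplaceWindow`

Route `ToronSmallBall` (D-0145 LINE g12-A of seat ym-idea-4; draft-by-design onto the Laplace window W = `SwapTwistDeficit.TwistDeficitLaplaceWindow`,
item stmt-QuantumFields-23776) splits the thermal small-ball hypothesis SB(a,γ) of the landed door `SwapTwistDeficit.twistDeficitLaplaceWindow_of_smallBall`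
(p681532) into the collapsed toron CORE (`ToronCoreRarity`: `{polDist ≤ β^{−γc}}` has slice-`0` thermal weight `≤ β^{−a₁} Z`) and the OFF-CORE strip
(`OffCoreStripWindow`: `{|polDist − polDist∘S| ≤ β^{−γ}, polDist > β^{−γc}}` has weight `≤ β^{−a′} Z` for every small window exponent `a′`).  This file proves the
route's Assembly: the strip is contained in CORE ∪ (STRIP ∩ OFF-CORE), the slice-`0` thermal weight `insTrace L β 𝟙_· 0` is monotone and subadditive
(`TT.insTrace_indicator_zero_mono`, §1 `TT.insTrace_indicator_zero_union_le`), so with `a′ = min a₀ a₁` and `a = a′/2` the strip has weight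
`≤ (β^{−a₁} + β^{−a′}) Z ≤ β^{−a}/8 · Z` once `β^{a′/2} ≥ 16`, the windows nest (`L ≤ β^{a} ⇒ L ≤ β^{a′} ≤ β^{a₁}`), `γ < 1/2 − 3a′ ≤ 1/2 − 3a`, and the door gives W.

HONEST FRAMING: pure bookkeeping (union bound + real-exponent monotonicity) on top of the landed door; the two cruxes of the route are OPEN; no summit / rung
statement is proved; the YM mass gap is NOT proved.  No `sorry`, no new axiom, no new definition.
References: [cite: MontvayMunster1994, (3.145)]; [cite: Luscher1983, §2].
-/

set_option autoImplicit false

noncomputable section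

open MeasureTheory Filter Topology Real Function
open scoped Matrix ComplexConjugate BigOperators
open Literature.MathematicalPhysics.QuantumLattice
open Literature.MathematicalPhysics.QuantumFieldTheory hiding SU2
open Summit.QuantumFields.YangMills.Theorems

namespace Summit.QuantumFields.YangMills.Theorems.FemtoTransferGap.TT

open Summit.QuantumFields.YangMills.Theorems.FemtoTransferGap

variable {L : ℕ} [NeZero L]

/-! ## §1 Subadditivity of the slice-`0` thermal weight -/

/-- **Subadditivity**: `insTrace L β 𝟙_{A ∪ B} 0 ≤ insTrace L β 𝟙_A 0 + insTrace L β 𝟙_B 0` for measurable slice events (`β ≥ 0`). [folklore] -/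
theorem insTrace_indicator_zero_union_le {β : ℝ} (hβ : 0 ≤ β) {A B : Set (GaugeConfig 3 L SU2)} (hA : MeasurableSet A) (hB : MeasurableSet B) :
    insTrace L β ((A ∪ B).indicator fun _ => (1 : ℝ)) 0 ≤
      insTrace L β (A.indicator fun _ => (1 : ℝ)) 0 + insTrace L β (B.indicator fun _ => (1 : ℝ)) 0 := by
  rw [insTrace_indicator_zero, insTrace_indicator_zero, insTrace_indicator_zero]
  have hm := measurable_chain (L := L) β
  set C : ℝ := (Real.exp (2 * β) ^ Fintype.card (Edge 3 L)) ^ (2 * L - 1) * Real.exp (2 * β) ^ Fintype.card (Edge 3 L) with hC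
  have hint : ∀ {S : Set (GaugeConfig 3 L SU2)}, MeasurableSet S → Integrable (fun Us : Fin (2 * L - 1 + 1) → GaugeConfig 3 L SU2 =>
      (∏ i : Fin (2 * L - 1), transferKernel su2Rep β (Us i.castSucc) (Us i.succ)) *
        physAvg (transferKernel su2Rep β (Us (Fin.last (2 * L - 1)))) (Us 0) * S.indicator (fun _ => (1 : ℝ)) (Us 0))
      (Measure.pi fun _ : Fin (2 * L - 1 + 1) => configMeasure SU2 L) := fun {S} hS => by
    refine integrable_of_measurable_abs_le _ (hm.mul ((measurable_const.indicator hS).comp (measurable_pi_apply 0))) (C := C) fun Us => ?_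
    have hind : |S.indicator (fun _ => (1 : ℝ)) (Us 0)| ≤ 1 := by
      by_cases hU : Us 0 ∈ S
      · rw [Set.indicator_of_mem hU, abs_one]
      · rw [Set.indicator_of_notMem hU, abs_zero]; exact zero_le_one
    calc |(∏ i : Fin (2 * L - 1), transferKernel su2Rep β (Us i.castSucc) (Us i.succ)) *
          physAvg (transferKernel su2Rep β (Us (Fin.last (2 * L - 1)))) (Us 0) * S.indicator (fun _ => (1 : ℝ)) (Us 0)|
        = |(∏ i : Fin (2 * L - 1), transferKernel su2Rep β (Us i.castSucc) (Us i.succ)) *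
          physAvg (transferKernel su2Rep β (Us (Fin.last (2 * L - 1)))) (Us 0)| * |S.indicator (fun _ => (1 : ℝ)) (Us 0)| := abs_mul _ _
      _ ≤ C * 1 := mul_le_mul (abs_chain_le hβ Us) hind (abs_nonneg _) (by positivity)
      _ = C := mul_one _
  rw [← integral_add (hint hA) (hint hB)]
  refine integral_mono (hint (hA.union hB)) ((hint hA).add (hint hB)) fun Us => ?_
  have h0 := chain_nonneg β Us
  have hle : (A ∪ B).indicator (fun _ => (1 : ℝ)) (Us 0) ≤ A.indicator (fun _ => (1 : ℝ)) (Us 0) + B.indicator (fun _ => (1 : ℝ)) (Us 0) := by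
    by_cases hUA : Us 0 ∈ A
    · rw [Set.indicator_of_mem (Set.mem_union_left B hUA), Set.indicator_of_mem hUA]
      linarith [Set.indicator_nonneg (fun _ _ => (zero_le_one : (0 : ℝ) ≤ 1)) (Us 0) (s := B)]
    · by_cases hUB : Us 0 ∈ B
      · rw [Set.indicator_of_mem (Set.mem_union_right A hUB), Set.indicator_of_mem hUB, Set.indicator_of_notMem hUA]; linarith
      · rw [Set.indicator_of_notMem (fun h => h.elim hUA hUB), Set.indicator_of_notMem hUA, Set.indicator_of_notMem hUB]; linarith
  calc (∏ i : Fin (2 * L - 1), transferKernel su2Rep β (Us i.castSucc) (Us i.succ)) *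
        physAvg (transferKernel su2Rep β (Us (Fin.last (2 * L - 1)))) (Us 0) * (A ∪ B).indicator (fun _ => (1 : ℝ)) (Us 0)
      ≤ (∏ i : Fin (2 * L - 1), transferKernel su2Rep β (Us i.castSucc) (Us i.succ)) *
        physAvg (transferKernel su2Rep β (Us (Fin.last (2 * L - 1)))) (Us 0) *
          (A.indicator (fun _ => (1 : ℝ)) (Us 0) + B.indicator (fun _ => (1 : ℝ)) (Us 0)) := mul_le_mul_of_nonneg_left hle h0
    _ = _ := by ring

end Summit.QuantumFields.YangMills.Theorems.FemtoTransferGap.TT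

namespace Summit.QuantumFields.YangMills.Theorems.ToronSmallBall

open Summit.QuantumFields.YangMills.Theorems.FemtoTransferGap
open Summit.QuantumFields.YangMills.Theorems.FemtoTransferGap.FlatSheet

/-! ## §2 The assembly -/

set_option maxHeartbeats 800000 in
/-- ★ **`ToronSmallBall.Assembly` holds**: `ToronCoreRarity → OffCoreStripWindow → TwistDeficitLaplaceWindow` (union bound on the strip
`⊆ CORE ∪ (STRIP ∩ OFF-CORE)`, exponent bookkeeping `a = min(a₀,a₁)/2`, and the landed door `twistDeficitLaplaceWindow_of_smallBall`).
[cite: MontvayMunster1994, (3.145)] [cite: Luscher1983, §2] -/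
theorem assembly_proof : Summit.QuantumFields.YangMills.Theses.ToronSmallBall.Assembly := by
  intro hX1 hX2
  obtain ⟨γc, hγc, a₁, ha₁, β₁, L₁, h1⟩ := hX1
  obtain ⟨a₀, ha₀, ha₀1, h2⟩ := hX2 γc hγc
  set a' : ℝ := min a₀ a₁ with ha'
  have ha'0 : 0 < a' := lt_min ha₀ ha₁
  have ha'₀ : a' ≤ a₀ := min_le_left _ _
  have ha'₁ : a' ≤ a₁ := min_le_right _ _
  obtain ⟨γ, hγ, β₂, L₂, h2'⟩ := h2 a' ha'0 ha'₀
  have hγ' : γ < 1 / 2 - 3 * (a' / 2) := by linarith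
  refine SwapTwistDeficit.twistDeficitLaplaceWindow_of_smallBall (a := a' / 2) (γ := γ) (by positivity) (by linarith) hγ'
    ⟨max (max β₁ β₂) (max 1 ((16 : ℝ) ^ (2 / a'))), max L₁ L₂, fun β hβ L _ hL hLβ => ?_⟩
  have hββ₁ : β₁ ≤ β := ((le_max_left _ _).trans (le_max_left _ _)).trans hβ
  have hββ₂ : β₂ ≤ β := ((le_max_right _ _).trans (le_max_left _ _)).trans hβ
  have hβ1 : 1 ≤ β := ((le_max_left _ _).trans (le_max_right _ _)).trans hβ
  have hβ16 : (16 : ℝ) ^ (2 / a') ≤ β := ((le_max_right _ _).trans (le_max_right _ _)).trans hβ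
  have hβ0 : 0 < β := by linarith
  have hL₁ : L₁ ≤ L := (le_max_left _ _).trans hL
  have hL₂ : L₂ ≤ L := (le_max_right _ _).trans hL
  have hL1 : 1 ≤ L := NeZero.one_le
  -- the windows nest
  have hLβ₁ : (L : ℝ) ≤ β ^ a₁ := hLβ.trans (Real.rpow_le_rpow_of_exponent_le hβ1 (by linarith))
  have hLβ' : (L : ℝ) ≤ β ^ a' := hLβ.trans (Real.rpow_le_rpow_of_exponent_le hβ1 (by linarith))
  have hcore := h1 β hββ₁ L hL₁ hLβ₁
  have hoff := h2' β hββ₂ L hL₂ hLβ'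
  set S := configPerm (G := FemtoTransferGap.SU2) (L := L) (Equiv.swap (0 : Fin 3) 1) with hS
  set Z : ℝ := TT.physTrace L β (2 * L) with hZ
  have hZpos : 0 < Z := TT.physTrace_two_mul_pos hL1 hβ1
  -- the three events
  set CORE : Set (GaugeConfig 3 L FemtoTransferGap.SU2) := {U | polDist U ≤ β ^ (-γc)} with hCORE
  set OFF : Set (GaugeConfig 3 L FemtoTransferGap.SU2) := {U | |polDist U - polDist (S U)| ≤ β ^ (-γ) ∧ β ^ (-γc) < polDist U} with hOFF
  set STRIP : Set (GaugeConfig 3 L FemtoTransferGap.SU2) := {U | |polDist U - polDist (S U)| ≤ β ^ (-γ)} with hSTRIP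
  have hCOREm : MeasurableSet CORE := measurableSet_le isPhys_polDist.measurable measurable_const
  have hOFFm : MeasurableSet OFF :=
    (measurableSet_strip _).inter (measurableSet_lt measurable_const isPhys_polDist.measurable)
  have hSTRIPm : MeasurableSet STRIP := measurableSet_strip _
  have hsub : STRIP ⊆ CORE ∪ OFF := fun U hU => by
    by_cases hc : polDist U ≤ β ^ (-γc)
    · exact Or.inl hc
    · exact Or.inr ⟨hU, not_le.1 hc⟩
  have hstrip : TT.insTrace L β (STRIP.indicator fun _ => (1 : ℝ)) 0 ≤ (β ^ (-a₁) + β ^ (-a')) * Z := by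
    calc TT.insTrace L β (STRIP.indicator fun _ => (1 : ℝ)) 0 ≤ TT.insTrace L β ((CORE ∪ OFF).indicator fun _ => (1 : ℝ)) 0 :=
          TT.insTrace_indicator_zero_mono hβ0.le hSTRIPm (hCOREm.union hOFFm) hsub
      _ ≤ TT.insTrace L β (CORE.indicator fun _ => (1 : ℝ)) 0 + TT.insTrace L β (OFF.indicator fun _ => (1 : ℝ)) 0 :=
          TT.insTrace_indicator_zero_union_le hβ0.le hCOREm hOFFm
      _ ≤ β ^ (-a₁) * Z + β ^ (-a') * Z := add_le_add hcore hoff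
      _ = (β ^ (-a₁) + β ^ (-a')) * Z := by ring
  -- exponents: `β^{-a₁} + β^{-a'} ≤ 2β^{-a'} ≤ β^{-a'/2}/8`
  have hmono : β ^ (-a₁) ≤ β ^ (-a') := Real.rpow_le_rpow_of_exponent_le hβ1 (by linarith)
  have h16 : (16 : ℝ) ≤ β ^ (a' / 2) := by
    have h := Real.rpow_le_rpow (by positivity) hβ16 (by positivity : (0 : ℝ) ≤ a' / 2)
    rwa [← Real.rpow_mul (by norm_num), show 2 / a' * (a' / 2) = 1 by field_simp, Real.rpow_one] at h
  have hkey : β ^ (-a₁) + β ^ (-a') ≤ β ^ (-(a' / 2)) / 8 := by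
    have e1 : β ^ (-a') = β ^ (-(a' / 2)) * (β ^ (a' / 2))⁻¹ := by
      rw [← Real.rpow_neg hβ0.le, ← Real.rpow_add hβ0]; congr 1; ring
    have hpos : 0 < β ^ (-(a' / 2)) := Real.rpow_pos_of_pos hβ0 _
    have hinv : (β ^ (a' / 2))⁻¹ ≤ 1 / 16 := by
      rw [inv_eq_one_div]; exact div_le_div_of_nonneg_left zero_le_one (by norm_num) h16
    calc β ^ (-a₁) + β ^ (-a') ≤ 2 * β ^ (-a') := by linarith
      _ = 2 * (β ^ (-(a' / 2)) * (β ^ (a' / 2))⁻¹) := by rw [e1]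
      _ ≤ 2 * (β ^ (-(a' / 2)) * (1 / 16)) := by
          refine mul_le_mul_of_nonneg_left (mul_le_mul_of_nonneg_left hinv hpos.le) (by norm_num)
      _ = β ^ (-(a' / 2)) / 8 := by ring
  calc TT.insTrace L β (STRIP.indicator fun _ => (1 : ℝ)) 0 ≤ (β ^ (-a₁) + β ^ (-a')) * Z := hstrip
    _ ≤ β ^ (-(a' / 2)) / 8 * Z := mul_le_mul_of_nonneg_right hkey hZpos.le

end Summit.QuantumFields.YangMills.Theorems.ToronSmallBall

end
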